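import Literature.IUT.HodgeTheaters.BadLocalFrobenioidBases
import Literature.AnabelianGeometry.EtaleTheta.ThetaEnvOfSetting
import Literature.AnabelianGeometry.EtaleTheta.SettingBridge
import Literature.AnabelianGeometry.SemiGraphs.TemperedOpenMapping
import HarnessLib

/-!
# [IUTchI] Ex. 3.2's group datum `Π^tp_{X̲̲_v} ↠ G_v ⊇ Π^tp_{Ÿ_v}` FROM the [EtTh] §1/§2 objects: the junction
# `BadLocalGroupDatum.ofDoubleUnderline` (L2 → L5 interface row «three laws»: topology on `G_K`, `aug` continuous
# and OPEN on `Π^tp_{X̲̲}`, `aug(Π^tp_{Ÿ̲̲}) = G_K`)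

S. Mochizuki, *Inter-universal Teichmüller Theory I*, Example 3.2 (i) p. 70, (ii) p. 70, (v) p. 72 («`D_v :=
B^temp(X̲̲_v)⁰`», «the tempered covering `Ÿ_v → X̲̲_v`», «the base field of `Ÿ_v` is equal to `K_v`»)
[cite: Mochizuki2012, I Ex 3.2 (i)(v) pp.70-72] (D-0012 claim key, status disputed; nothing of the series is asserted);
S. Mochizuki, *The étale theta function …* [EtTh], §2 Def. 2.1 p. 36 / Prop. 2.2 (iii) p. 37 («`X̲̲^log → X^log`»,
«`G_K ≅ Π_{X̲̲}/Δ_{X̲̲}`»), §1 p. 13 [cite: MochizukiEtTh2009, Prop 2.2 (iii) p.37]; [SemiAnbd] §6 p. 69 («`G_K :=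
Gal(K̄/K)`», the augmentation) [cite: MochizukiSemiAnbd2006, §6 p.69].

Cell abc-iut, seat abc-iut-L2-t7 (gen 4), row R360 «TEMPEREDCOVERDATA THREE LAWS AT THE GENUINE TATE-CURVE DATUM —
INTERFACE ROW» (abc-iut-L2-lead R382 / abc-iut-L5-lead RULINGS #59 (3); plan/L5/SUBDAG-IUTchI-Ex32.md §H (β):
«L2's `ThetaCovers.TemperedCoverData` has Gtp/PiYddtp/toHat but NO topology on G_K, no continuity/openness of aug ∘ toHat,
no «aug(Π^tp_Ÿ̲̲) = G_K» law — three interface laws short of a genuine `BadLocalGroupDatum`»).  JUNCTION FILE (one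
writer per interface: abc-iut-L5-t2's `BadLocalGroupDatum` and abc-iut-L2-t8's `EtaleThetaData.DoubleUnderline` are
consumed BY NAME, untouched).  The three laws are ALL AVAILABLE at the [EtTh] §1 objects of record — the curve
`X̲̲` of type `(1, (ℤ/l)^Θ)` is abc-iut-L2-t8's `EtaleThetaData.DoubleUnderline` (`Π^tp_{X̲̲} := C.Huu ≤ Π^tp_X`, an OPEN
subgroup, with the LAW `map_aug_Ydduu : aug(Π^tp_Ÿ ∩ Π^tp_{X̲̲}) = G_K` as a FIELD) — so no new interface clause is
needed:

* (i) «topology on `G_K`»: `G_K = Fix(K) ≤ Gal(ℚ̄_p/ℚ_p)` with the subspace Krull topology (abc-iut-L3's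
  `TemperedCurve.GK`), transported along ANY identification `ι : G_K ≃ₜ* G` supplied by the consumer (for the L5 datum:
  `G = Gal(Ω/k)` of a `GaloisValDatum`; abc-iut-L3-t12's `galoisIdentification` / abc-iut-L4's `PadicAlgCl.subfieldGalEquiv`
  are such `ι`'s) — the junction is PARAMETRISED by `ι`;
* (ii) «`aug ∘ toHat` continuous and OPEN»: `augOfDoubleUnderline ι C := ι ∘ augGK|_{Π^tp_{X̲̲}}` is continuous (abc-iut-L3's
  `TemperedCurve.augGK`) and OPEN — `aug : Π^tp_X → G_{ℚ_p}` is an open map for every setting carrying the group-level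
  bundle (abc-iut-L3 `TemperedCurve.isOpenMap_aug_of_groupLevelData`, [SemiAnbd] Thm. 6.8 sub-DAG: `Π^tp_X` tempered +
  Galois-countable), `Π^tp_{X̲̲}` is open in `Π^tp_X`, `G_K` is open in `G_{ℚ_p}`;
* (iii) «`aug(Π^tp_{Ÿ̲̲}) = G_K`»: `Π^tp_{Ÿ̲̲} := Π^tp_Ÿ ∩ Π^tp_{X̲̲}` is an OPEN subgroup of `Π^tp_{X̲̲}` (`Π^tp_Ÿ` open under
  `K = K̈`, abc-iut-L2's `isOpen_GtpYdd`) mapping ONTO `G_K` (the DoubleUnderline law `map_aug_Ydduu`);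
* **`BadLocalGroupDatum.ofDoubleUnderline d hS C ι : BadLocalGroupDatum G ↥C.Huu`** — the assembled datum, with
  `ofDoubleUnderline_aug_apply`, `ofDoubleUnderline_Y` (`rfl` bookkeeping).

Inputs, all BY NAME: the group-level bundle `d : GroupLevelData` (abc-iut-L3; e.g. `e.toGroupLevelData` of the
once-punctured bundle `e` — for the openness of `aug`), `hS : Sec2Hyps` (`K = K̈`,
for the openness of `Π^tp_Ÿ`), `C : E.DoubleUnderline l`, `ι`.  DEFS-FREEZE class (b): ONE construction over existing
interfaces (no field added anywhere; 0 instances, 0 notation, no `Prop` fact).  HONEST FRAMING: nothing asserts that a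
`ThetaSetting` / `EtaleThetaData` / `DoubleUnderline` arises from an actual Tate curve; [EtTh]/[SemiAnbd] are refereed
inputs, [IUTchI] is disputed and nothing of it is asserted; no side taken on [IUTchIII] Cor. 3.12; typed ≠ proved.
-/

noncomputable section

namespace Literature.IUT.HodgeTheaters

open Literature.AnabelianGeometry.SemiGraphs Literature.AnabelianGeometry.EtaleTheta _root_.Topology

namespace BadLocalGroupDatum

variable {p : ℕ} [Fact p.Prime] {D : ThetaSetting p} {E : D.EtaleThetaData} {l : ℕ}
variable {G : Type} [Group G] [TopologicalSpace G]

/-! ### (ii) the augmentation of `Π^tp_{X̲̲}`, continuous and open -/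

/-- **The augmentation `Π^tp_{X̲̲} → G`**: `aug` of the setting restricted to the open subgroup `Π^tp_{X̲̲} = C.Huu`,
with values in `G_K` (abc-iut-L3's `augGK`), transported along the consumer's identification `ι : G_K ≃ₜ* G`.
[cite: MochizukiSemiAnbd2006, §6 p.69] -/
def augOfDoubleUnderline (ι : ↥D.GK ≃ₜ* G) (C : E.DoubleUnderline l) : ↥C.Huu →* G :=
  ι.toMulEquiv.toMonoidHom.comp (D.toTemperedCurve.augGK.toMonoidHom.comp C.Huu.subtype)

/-- Formula: `aug x = ι ⟨aug_X x, _⟩`. [cite: MochizukiSemiAnbd2006, §6 p.69] -/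
theorem augOfDoubleUnderline_apply (ι : ↥D.GK ≃ₜ* G) (C : E.DoubleUnderline l) (x : ↥C.Huu) :
    augOfDoubleUnderline ι C x = ι (D.toTemperedCurve.augGK (x : D.PiTemp)) := rfl

/-- (ii, continuity) the augmentation of `Π^tp_{X̲̲}` is continuous. [cite: MochizukiSemiAnbd2006, §6 p.69] -/
theorem continuous_augOfDoubleUnderline (ι : ↥D.GK ≃ₜ* G) (C : E.DoubleUnderline l) :
    Continuous (augOfDoubleUnderline ι C) :=
  ι.continuous.comp (D.toTemperedCurve.augGK.continuous.comp continuous_subtype_val)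

/-- `augGK : Π^tp_X → G_K` is an OPEN map for a setting carrying the group-level bundle (`aug : Π^tp_X → G_{ℚ_p}` is
open by abc-iut-L3's `isOpenMap_aug_of_groupLevelData`, and `G_K` carries the subspace topology).
[cite: MochizukiSemiAnbd2006, §6 p.71] -/
theorem isOpenMap_augGK (d : D.toTemperedCurve.GroupLevelData) : IsOpenMap D.toTemperedCurve.augGK := by
  intro U hU
  have hopen : IsOpen (D.aug '' U) := D.toTemperedCurve.isOpenMap_aug_of_groupLevelData d U hU
  have hset : (D.toTemperedCurve.augGK '' U : Set ↥D.GK) = ((↑) : ↥D.GK → GQp p) ⁻¹' (D.aug '' U) := by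
    ext σ
    constructor
    · rintro ⟨x, hx, rfl⟩
      exact ⟨x, hx, rfl⟩
    · rintro ⟨x, hx, hxσ⟩
      exact ⟨x, hx, Subtype.ext hxσ⟩
  rw [hset]
  exact hopen.preimage continuous_subtype_val

/-- **(ii, openness) the augmentation `Π^tp_{X̲̲} → G` is an OPEN map** (`Π^tp_{X̲̲}` open in `Π^tp_X`, `augGK` open,
`ι` a homeomorphism). [cite: MochizukiSemiAnbd2006, §6 p.71] -/
theorem isOpenMap_augOfDoubleUnderline (d : D.toTemperedCurve.GroupLevelData) (ι : ↥D.GK ≃ₜ* G)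
    (C : E.DoubleUnderline l) : IsOpenMap (augOfDoubleUnderline ι C) :=
  (ι.toHomeomorph.isOpenMap.comp (isOpenMap_augGK d)).comp C.isOpen_Huu.isOpenMap_subtype_val

/-! ### (iii) `Π^tp_{Ÿ̲̲} ⊆ Π^tp_{X̲̲}`, open, onto `G_K` -/

/-- **`Π^tp_{Ÿ̲̲} := Π^tp_Ÿ ∩ Π^tp_{X̲̲}` as an OPEN subgroup of `Π^tp_{X̲̲}`** (`Π^tp_Ÿ` is open under `K = K̈`,
abc-iut-L2's `isOpen_GtpYdd`) — [IUTchI] Ex. 3.2 (ii) p. 70's «`Ÿ_v → X̲̲_v` … the tempered covering determined by the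
object `Ÿ^log` in the discussion at the beginning of [EtTh], §5 … in the "double underline case"», i.e. [EtTh]'s `Ÿ̲̲`.
[cite: Mochizuki2012, I Ex 3.2 (ii) p.70] -/
def Ydduu (hS : D.Sec2Hyps) (C : E.DoubleUnderline l) : OpenSubgroup ↥C.Huu where
  toSubgroup := D.GtpYdd.subgroupOf C.Huu
  isOpen' := (ThetaSetting.EtaleThetaData.DoubleUnderline.isOpen_GtpYdd hS).preimage continuous_subtype_val

/-- Membership in `Π^tp_{Ÿ̲̲}`: an element of `Π^tp_{X̲̲}` lying in `Π^tp_Ÿ`. [cite: MochizukiEtTh2009, Def 2.1 p.36] -/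
theorem mem_Ydduu_iff (hS : D.Sec2Hyps) (C : E.DoubleUnderline l) (x : ↥C.Huu) :
    x ∈ Ydduu hS C ↔ (x : D.PiTemp) ∈ D.GtpYdd := Subgroup.mem_subgroupOf

/-- **(iii) «the base field of `Ÿ̲̲` is `K`»: `aug(Π^tp_{Ÿ̲̲}) = ⊤`** — the DoubleUnderline law `map_aug_Ydduu` read through
`augGK` and `ι`. [cite: MochizukiEtTh2009, Prop 2.2 (iii) p.37] -/
theorem map_augOfDoubleUnderline_Ydduu (hS : D.Sec2Hyps) (ι : ↥D.GK ≃ₜ* G) (C : E.DoubleUnderline l) :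
    (Ydduu hS C).toSubgroup.map (augOfDoubleUnderline ι C) = ⊤ := by
  rw [eq_top_iff]
  intro g _
  -- `ι⁻¹ g ∈ G_K = aug(Π^tp_Ÿ ∩ Π^tp_{X̲̲})`
  have hmem : ((ι.symm g : ↥D.GK) : GQp p) ∈ (D.GtpYdd ⊓ C.Huu).map D.aug.toMonoidHom := by
    rw [C.map_aug_Ydduu]; exact (ι.symm g).2
  obtain ⟨x, ⟨hxY, hxH⟩, hx⟩ := hmem
  refine ⟨⟨x, hxH⟩, (mem_Ydduu_iff hS C _).mpr hxY, ?_⟩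
  rw [augOfDoubleUnderline_apply]
  have hGK : D.toTemperedCurve.augGK x = ι.symm g := Subtype.ext hx
  rw [hGK, ContinuousMulEquiv.apply_symm_apply]

/-! ### The junction -/

/-- **[IUTchI] Ex. 3.2's group datum FROM the [EtTh] §1 double-underline curve**: `Π_v := Π^tp_{X̲̲}` (`= C.Huu`),
`aug := ι ∘ augGK|_{Π^tp_{X̲̲}}` (continuous, open), `Π_Ÿ := Π^tp_{Ÿ̲̲} = Π^tp_Ÿ ∩ Π^tp_{X̲̲}` (open, onto `G`) — the three
interface laws of row R360 supplied as theorems. [cite: Mochizuki2012, I Ex 3.2 (i)(v) pp.70-72] -/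
def ofDoubleUnderline (d : D.toTemperedCurve.GroupLevelData) (hS : D.Sec2Hyps) (C : E.DoubleUnderline l)
    (ι : ↥D.GK ≃ₜ* G) : BadLocalGroupDatum G ↥C.Huu where
  aug := augOfDoubleUnderline ι C
  continuous_aug := continuous_augOfDoubleUnderline ι C
  isOpenMap_aug := isOpenMap_augOfDoubleUnderline d ι C
  Y := Ydduu hS C
  map_Y := map_augOfDoubleUnderline_Ydduu hS ι C

/-- Bookkeeping: the augmentation of the junction datum. [cite: Mochizuki2012, I Ex 3.2 (i) p.70] -/
@[simp] theorem ofDoubleUnderline_aug (d : D.toTemperedCurve.GroupLevelData) (hS : D.Sec2Hyps) (C : E.DoubleUnderline l)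
    (ι : ↥D.GK ≃ₜ* G) : (ofDoubleUnderline d hS C ι).aug = augOfDoubleUnderline ι C := rfl

/-- Bookkeeping: the covering subgroup of the junction datum is `Π^tp_{Ÿ̲̲}`. [cite: Mochizuki2012, I Ex 3.2 (ii) p.70] -/
@[simp] theorem ofDoubleUnderline_Y (d : D.toTemperedCurve.GroupLevelData) (hS : D.Sec2Hyps) (C : E.DoubleUnderline l)
    (ι : ↥D.GK ≃ₜ* G) : (ofDoubleUnderline d hS C ι).Y = Ydduu hS C := rfl

/-- `aug` of the junction datum is surjective (abc-iut-L5-t2's `surjective_aug`, here from law (iii)).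
[cite: Mochizuki2012, I Ex 3.2 (v) p.72] -/
theorem ofDoubleUnderline_aug_surjective (d : D.toTemperedCurve.GroupLevelData) (hS : D.Sec2Hyps) (C : E.DoubleUnderline l)
    (ι : ↥D.GK ≃ₜ* G) : Function.Surjective (ofDoubleUnderline d hS C ι).aug :=
  (ofDoubleUnderline d hS C ι).surjective_aug

/-- **Existence form for the L5 census**: over every [EtTh] §1 setting with the group-level bundle, `K = K̈`, an
étale theta datum and a double-underline curve `X̲̲`, and every identification `ι : G_K ≃ₜ* G`, the [IUTchI] Ex. 3.2
group datum `BadLocalGroupDatum G Π^tp_{X̲̲}` is INHABITED. [cite: Mochizuki2012, I Ex 3.2 (i)(v) pp.70-72] -/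
theorem nonempty_ofDoubleUnderline (d : D.toTemperedCurve.GroupLevelData) (hS : D.Sec2Hyps) (C : E.DoubleUnderline l)
    (ι : ↥D.GK ≃ₜ* G) : Nonempty (BadLocalGroupDatum G ↥C.Huu) :=
  ⟨ofDoubleUnderline d hS C ι⟩

end BadLocalGroupDatum

end Literature.IUT.HodgeTheaters

end
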